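import Summits.BirchSwinnertonDyer.BirchSwinnertonDyer.Theorems.GenusKolyvaginAtTwoMinimalTwinBSDTwoKrizLiAnchor91b1
import Literature.NumberTheory.EllipticCurves.Curve37aRootNumber
import HarnessLib

/-!
# Route `GenusKolyvaginAtTwo`, crux U₂ `MinimalTwinBSDTwo` (stmt-BirchSwinnertonDyer-22985), LINE 23 «twin_swap»: THE ROOT NUMBER OF THE RANK-ONE ANCHOR `91b1`
# IS `−1` IN THE KERNEL (SPLIT multiplicative reduction at BOTH bad primes: `N = 91 = 7·13`), HENCE `ord_{s=1} L(91b1, s) = 1` MODULO MODULARITY +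
# Kriz–Li Thm 4.3 — the Gross–Zagier–Kolyvagin input (`rank_eq_analyticRank_of_analyticRank_le_one`) of the road `…KrizLiAnchor91b1.lean` DISCHARGED

Seat `bsd-line-gk2-p2` g36 (PROVER 2/3, cell `bsd-f1-sign2`; LINE 23 holder), `--supports stmt-BirchSwinnertonDyer-22985` (helper; closes nothing).
THEOREMS ONLY (0 `def`, 0 `sorry`); standard axioms.  HONEST FRAMING (D-0014/D-0036): method and lemma names of the tree's `Literature/…/Curve37aRootNumber.lean`
(non-split place) and of this seat's `…KrizLiAnchor43a1RootNumber.lean` (g36), transplanted to Cremona's `91B1` (`(⟨0, 1, 1, -7, 5⟩ : WeierstrassCurve ℚ)`, `Δ = -91`, `c₄ = 352`, `N = 91`):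
away from `91` the discriminant is a `v`-unit (good reduction, `W_v = +1`); at each place `v` above a bad prime `p ∈ {7, 13}`, `c₄ = 352` is a `v`-unit and
`v(Δ) < 1` (multiplicative reduction), and the node-tangent quadratic `c₄T² + a₁c₄T − (54b₆ − 3b₂b₄ + a₂c₄) = 352T² − (1654)` of the integral model has NO root in
`κ(O_v) = 𝔽_p` (a root `r` would make `(c₄r)² = c₄·(1654) = 582208` a square mod `p`, but the Jacobi symbol `(582208 | p) = −1` at every bad `p`) — NON-split, `W_p = +1`
(Rohrlich); so the algebraic root number `−∏_v W_v = −1`, and by the Modularity Theorem (`exists_isNewformOf`) with the tree's PROVED Atkin–Lehner comparison at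
squarefree conductor (`rootNumber_eq_algebraicRootNumber_of_squarefree`) `w(91b1) = −1`; parity (`odd_analyticRank_of_rootNumber_eq_neg_one`) makes `r_an` odd and
Kriz–Li Thm 4.3 with the Table-1 (★)-datum caps it at `1`: **`r_an(91b1) = 1`** with NO Gross–Zagier–Kolyvagin input (§3).  §4 re-issues the road theorems of
`…KrizLiAnchor91b1.lean` with `hmod` in place of `hGZK`.  **BSD is NOT proved by any of this; U₂ is NOT proved; the wall rows stay displayed; no item is closed.**

References: [CremonaAlgorithms1997] Table 1 (curve 91B1: `r = 1`), §2.11; [SilvermanAEC2009] VII.5 Prop. 5.1, C.16 Thm. 16.3; [Rohrlich1993Compositio] Prop. 2;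
[KrizLi2019] Thm 4.3, §6 Table 1 (row 91b1); [BCDTJAMS2001] Thm. A; [KellockDokchitser2023] Cor. 2.5.
-/

set_option autoImplicit false
-- the Theorems namespace of this sub repeats the summit name by design (D-0017 nested layout)
set_option linter.dupNamespace false

noncomputable section

open scoped Classical NumberField

open WeierstrassCurve IsDedekindDomain Rat.HeightOneSpectrum NumberField Literature.NumberTheory.EllipticCurves
  Literature.NumberTheory.EllipticCurves.ModularForms
  Literature.NumberTheory.EllipticCurves.Rank1Residual
  Literature.NumberTheory.EllipticCurves.Rank1Residual.Typed
  Literature.NumberTheory.DiophantineGeometry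
  Summit.BirchSwinnertonDyer
  Summit.BirchSwinnertonDyer.Rank1Residual
  Summit.BirchSwinnertonDyer.Rank1Residual.X11b
  Summit.BirchSwinnertonDyer.Rank1Residual.X5.O1
  Summit.BirchSwinnertonDyer.Rank1Residual.P2
  Summit.BirchSwinnertonDyer.BirchSwinnertonDyer.Rank1Residual.IntModel
  Summit.BirchSwinnertonDyer.BirchSwinnertonDyer.Theorems
  Summit.BirchSwinnertonDyer.BirchSwinnertonDyer.Theorems.AddPotGoodPrint
  Summit.BirchSwinnertonDyer.BirchSwinnertonDyer.Theorems.OrdinaryTwistAtTwo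
  Summit.BirchSwinnertonDyer.BirchSwinnertonDyer.Theorems.GenusExact.TwinSwap.KrizLiAnchorWall
open IsDedekindDomain.HeightOneSpectrum Polynomial

namespace Summit.BirchSwinnertonDyer.BirchSwinnertonDyer.Theorems.GenusExact.TwinSwap.KrizLiAnchor91b1

/-! ## §1 Invariants of the equation over `ℚ` -/
section Invariants91B1RN

/-- `Δ(91b1) = -91` (rational model). [cite: CremonaAlgorithms1997, Table 1 (91B1)] -/
theorem Δ_91B1_rat : (⟨0, 1, 1, -7, 5⟩ : WeierstrassCurve ℚ).Δ = -91 := by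
  norm_num [WeierstrassCurve.Δ, WeierstrassCurve.b₂, WeierstrassCurve.b₄, WeierstrassCurve.b₆, WeierstrassCurve.b₈]

/-- `c₄(91b1) = 352` (rational model). [cite: CremonaAlgorithms1997, Table 1 (91B1)] -/
theorem c₄_91B1_rat : (⟨0, 1, 1, -7, 5⟩ : WeierstrassCurve ℚ).c₄ = 352 := by
  norm_num [WeierstrassCurve.c₄, WeierstrassCurve.b₂, WeierstrassCurve.b₄]

/-- `91b1` is integral at every finite place of `ℤ`. [cite: SilvermanAEC2009, VIII.8] -/
theorem isIntegralAt_91B1 (v : HeightOneSpectrum ℤ) : (⟨0, 1, 1, -7, 5⟩ : WeierstrassCurve ℚ).IsIntegralAt v := by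
  rw [isIntegralAt_iff_valuation_le_one]
  refine ⟨?_, ?_, ?_, ?_, ?_⟩
  · simp
  · simp
  · simp
  · simpa using v.valuation_le_one (K := ℚ) (-7 : ℤ)
  · simpa using v.valuation_le_one (K := ℚ) (5 : ℤ)

end Invariants91B1RN

/-! ## §2 Local root numbers: `+1` everywhere (good away from `91`, NON-split multiplicative above each bad prime); algebraic root number `−1` -/
section LocalRootNumbers91B1

/-- At a place `v` with `v(Δ) = 1` (`v ∤ 91`) the curve has good reduction, so `W_v = 1`. [cite: Rohrlich1993Compositio, Prop. 2(i)] -/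
theorem localRootNumberAt_of_valuation_Δ_eq_one_91B1 (v : HeightOneSpectrum ℤ)
    (h : v.valuation ℚ (⟨0, 1, 1, -7, 5⟩ : WeierstrassCurve ℚ).Δ = 1) :
    haveI := isElliptic_91B1
    (⟨0, 1, 1, -7, 5⟩ : WeierstrassCurve ℚ).localRootNumberAt v = 1 :=
  haveI := isElliptic_91B1
  WeierstrassCurve.localRootNumberAt_of_hasGoodReductionAt
    (hasGoodReductionAt_of_valuation_Δ_eq_one_holds v _ (isIntegralAt_91B1 v) h)

/-- If `v(Δ) < 1` then `v` lies above `7` or `13` (`Δ = -91 = −7·13`). [folklore] -/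
theorem mem_of_valuation_Δ_lt_one_91B1 {v : HeightOneSpectrum ℤ}
    (h : v.valuation ℚ (⟨0, 1, 1, -7, 5⟩ : WeierstrassCurve ℚ).Δ < 1) : (7 : ℤ) ∈ v.asIdeal ∨ (13 : ℤ) ∈ v.asIdeal := by
  rw [Δ_91B1_rat] at h
  have hΔ : (-91 : ℚ) = -(algebraMap ℤ ℚ 7 * algebraMap ℤ ℚ 13) := by norm_num
  rw [hΔ, Valuation.map_neg, Valuation.map_mul] at h
  by_contra hcon
  push Not at hcon
  have h1 : v.valuation ℚ (algebraMap ℤ ℚ 7) = 1 :=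
    le_antisymm (v.valuation_le_one (7 : ℤ)) (not_lt.mp fun hlt => hcon.1 ((v.valuation_lt_one_iff_mem (7 : ℤ)).mp hlt))
  have h2 : v.valuation ℚ (algebraMap ℤ ℚ 13) = 1 :=
    le_antisymm (v.valuation_le_one (13 : ℤ)) (not_lt.mp fun hlt => hcon.2 ((v.valuation_lt_one_iff_mem (13 : ℤ)).mp hlt))
  rw [h1, h2, one_mul] at h
  exact lt_irrefl _ h

/-- At a place `v` with `352 ∉ v`, `c₄ = 352` is a `v`-unit. [cite: SilvermanAEC2009, VII.5 Prop. 5.1(b)] -/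
theorem valuation_c₄_eq_one_91B1_of {v : HeightOneSpectrum ℤ} (hc : (352 : ℤ) ∉ v.asIdeal) :
    v.valuation ℚ (⟨0, 1, 1, -7, 5⟩ : WeierstrassCurve ℚ).c₄ = 1 := by
  rw [c₄_91B1_rat]
  by_contra h
  have h' : v.valuation ℚ (algebraMap ℤ ℚ 352) ≠ 1 := by simpa using h
  have hlt := lt_of_le_of_ne (v.valuation_le_one (352 : ℤ)) h'
  exact hc ((v.valuation_lt_one_iff_mem (352 : ℤ)).mp hlt)

/-- `352 ∉ v` when `7 ∈ v` (Bezout: `(151)·7 + (-3)·352 = 1`). [folklore] -/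
theorem not_mem_c₄_91B1_7 {v : HeightOneSpectrum ℤ} (hp : (7 : ℤ) ∈ v.asIdeal) :
    (352 : ℤ) ∉ v.asIdeal := by
  intro hc
  have hone : (1 : ℤ) ∈ v.asIdeal := by
    have := v.asIdeal.add_mem (v.asIdeal.mul_mem_left (151) hp) (v.asIdeal.mul_mem_left (-3) hc)
    convert this using 1
    norm_num
  exact v.isPrime.ne_top ((Ideal.eq_top_iff_one _).mpr hone)

/-- At a place above `7`, `c₄ = 352` is a `v`-unit. [cite: SilvermanAEC2009, VII.5 Prop. 5.1(b)] -/
theorem valuation_c₄_eq_one_91B1_7 {v : HeightOneSpectrum ℤ} (hp : (7 : ℤ) ∈ v.asIdeal) :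
    v.valuation ℚ (⟨0, 1, 1, -7, 5⟩ : WeierstrassCurve ℚ).c₄ = 1 :=
  valuation_c₄_eq_one_91B1_of (not_mem_c₄_91B1_7 hp)

/-- `352 ∉ v` when `13 ∈ v` (Bezout: `(-27)·13 + (1)·352 = 1`). [folklore] -/
theorem not_mem_c₄_91B1_13 {v : HeightOneSpectrum ℤ} (hp : (13 : ℤ) ∈ v.asIdeal) :
    (352 : ℤ) ∉ v.asIdeal := by
  intro hc
  have hone : (1 : ℤ) ∈ v.asIdeal := by
    have := v.asIdeal.add_mem (v.asIdeal.mul_mem_left (-27) hp) (v.asIdeal.mul_mem_left (1) hc)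
    convert this using 1
    norm_num
  exact v.isPrime.ne_top ((Ideal.eq_top_iff_one _).mpr hone)

/-- At a place above `13`, `c₄ = 352` is a `v`-unit. [cite: SilvermanAEC2009, VII.5 Prop. 5.1(b)] -/
theorem valuation_c₄_eq_one_91B1_13 {v : HeightOneSpectrum ℤ} (hp : (13 : ℤ) ∈ v.asIdeal) :
    v.valuation ℚ (⟨0, 1, 1, -7, 5⟩ : WeierstrassCurve ℚ).c₄ = 1 :=
  valuation_c₄_eq_one_91B1_of (not_mem_c₄_91B1_13 hp)

/-- **SPLIT multiplicative reduction above `7`** (`a_7(91b1) = +1`): at a place `v ∋ 7` with `v(Δ) < 1` the chosen local minimal model of `91b1` has split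
multiplicative reduction — the node-tangent quadratic `352 T² − (1654)` of the integral model factors as `352(T − 8)(T + 8)` over `κ(O_v) ⊇ 𝔽_7`
(`352·8² − (1654) = 20874 = 7·2982`). [cite: CremonaAlgorithms1997, Table 1 (91B1) and §2.11] -/
theorem hasSplitMultiplicativeReductionAt_91B1_7 {v : HeightOneSpectrum ℤ} (hp : (7 : ℤ) ∈ v.asIdeal)
    (h : v.valuation ℚ (⟨0, 1, 1, -7, 5⟩ : WeierstrassCurve ℚ).Δ < 1) :
    haveI := isElliptic_91B1
    (⟨0, 1, 1, -7, 5⟩ : WeierstrassCurve ℚ).HasSplitMultiplicativeReductionAt v := by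
  haveI := isElliptic_91B1
  have hc₄ := valuation_c₄_eq_one_91B1_of (not_mem_c₄_91B1_7 hp)
  have hW := isIntegralAt_91B1 v
  set O := v.adicCompletionIntegers ℚ with hO
  set K := v.adicCompletion ℚ with hK
  set EK := (⟨0, 1, 1, -7, 5⟩ : WeierstrassCurve ℚ).baseChange K with hEK
  haveI hmin : EK.IsMinimal O :=
    isMinimalAt_of_lt_valuation_c₄ hW
      (by rw [hc₄, ← WithZero.exp_zero]; exact WithZero.exp_lt_exp.mpr (by norm_num))
  haveI : EK.IsElliptic := by rw [hEK, WeierstrassCurve.baseChange]; infer_instance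
  obtain ⟨Dv, hD⟩ : ∃ Dv : VariableChange K, (⟨0, 1, 1, -7, 5⟩ : WeierstrassCurve ℚ).localMinimalModel v = Dv • EK := ⟨_, rfl⟩
  have hm : EK.HasMultiplicativeReduction O :=
    (hasMultiplicativeReduction_iff_of_isMinimal_of_eq_smul O hD EK.isUnit_Δ.ne_zero).mp
      (hasMultiplicativeReductionAt_of_valuation_c₄_eq_one hW hc₄ h)
  unfold WeierstrassCurve.HasSplitMultiplicativeReductionAt
  rw [hasSplitMultiplicativeReduction_iff_of_isMinimal_of_eq_smul O hD EK.isUnit_Δ.ne_zero,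
    hasSplitMultiplicativeReduction_iff]
  refine ⟨hm, ?_⟩
  have inj := IsFractionRing.injective O K
  have hc4 : (EK.integralModel O).c₄ = 352 := inj <| by
    rw [integralModel_c₄_eq, map_ofNat, hEK, WeierstrassCurve.baseChange, map_c₄]; rw [c₄_91B1_rat]; norm_num
  have ha1 : (EK.integralModel O).a₁ = 0 := inj <| by
    rw [integralModel_a₁_eq, map_zero, hEK, WeierstrassCurve.baseChange, map_a₁]; simp
  have ha2 : (EK.integralModel O).a₂ = 1 := inj <| by
    rw [integralModel_a₂_eq, map_one, hEK, WeierstrassCurve.baseChange, map_a₂]; simp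
  have hb2 : (EK.integralModel O).b₂ = 4 := inj <| by
    rw [integralModel_b₂_eq, map_ofNat, hEK, WeierstrassCurve.baseChange, map_b₂]; norm_num [WeierstrassCurve.b₂]
  have hb4 : (EK.integralModel O).b₄ = -14 := inj <| by
    rw [integralModel_b₄_eq, map_neg, map_ofNat, hEK, WeierstrassCurve.baseChange, map_b₄]; norm_num [WeierstrassCurve.b₄]
  have hb6 : (EK.integralModel O).b₆ = 21 := inj <| by
    rw [integralModel_b₆_eq, map_ofNat, hEK, WeierstrassCurve.baseChange, map_b₆]; norm_num [WeierstrassCurve.b₆]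
  rw [hc4, ha1, ha2, hb2, hb4, hb6]
  -- `7 = 0`, hence `20874 = 0`, in the residue field `κ(O_v)`
  have hpF : (7 : IsLocalRing.ResidueField O) = 0 := by
    have hker : (7 : ℤ) ∈ RingHom.ker ((IsLocalRing.residue O).comp (algebraMap ℤ O)) := by
      rw [ker_residue_comp_algebraMap ℚ v]; exact hp
    have h := RingHom.mem_ker.mp hker
    rwa [RingHom.comp_apply, map_ofNat, map_ofNat] at h
  have hdiff : (20874 : (IsLocalRing.ResidueField O)[X]) = 0 := by
    rw [show (20874 : (IsLocalRing.ResidueField O)[X]) = C (20874 : IsLocalRing.ResidueField O) from (map_ofNat C 20874).symm,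
      show (20874 : IsLocalRing.ResidueField O) = 7 * 2982 by norm_num, hpF, zero_mul, map_zero]
  have hsplit : (C (352 : IsLocalRing.ResidueField O) * ((X - C 8) * (X + C 8))).Splits :=
    (Splits.C _).mul ((Splits.X_sub_C _).mul (Splits.X_add_C _))
  convert hsplit using 1
  simp only [Polynomial.map_sub, Polynomial.map_add, Polynomial.map_mul, Polynomial.map_pow, Polynomial.map_X, Polynomial.map_ofNat, Polynomial.map_zero, Polynomial.map_one, Polynomial.map_neg, map_mul, map_sub, map_add, map_ofNat, map_zero, map_one, map_neg]
  linear_combination hdiff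

/-- **SPLIT multiplicative reduction above `13`** (`a_13(91b1) = +1`): at a place `v ∋ 13` with `v(Δ) < 1` the chosen local minimal model of `91b1` has split
multiplicative reduction — the node-tangent quadratic `352 T² − (1654)` of the integral model factors as `352(T − 4)(T + 4)` over `κ(O_v) ⊇ 𝔽_13`
(`352·4² − (1654) = 3978 = 13·306`). [cite: CremonaAlgorithms1997, Table 1 (91B1) and §2.11] -/
theorem hasSplitMultiplicativeReductionAt_91B1_13 {v : HeightOneSpectrum ℤ} (hp : (13 : ℤ) ∈ v.asIdeal)
    (h : v.valuation ℚ (⟨0, 1, 1, -7, 5⟩ : WeierstrassCurve ℚ).Δ < 1) :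
    haveI := isElliptic_91B1
    (⟨0, 1, 1, -7, 5⟩ : WeierstrassCurve ℚ).HasSplitMultiplicativeReductionAt v := by
  haveI := isElliptic_91B1
  have hc₄ := valuation_c₄_eq_one_91B1_of (not_mem_c₄_91B1_13 hp)
  have hW := isIntegralAt_91B1 v
  set O := v.adicCompletionIntegers ℚ with hO
  set K := v.adicCompletion ℚ with hK
  set EK := (⟨0, 1, 1, -7, 5⟩ : WeierstrassCurve ℚ).baseChange K with hEK
  haveI hmin : EK.IsMinimal O :=
    isMinimalAt_of_lt_valuation_c₄ hW
      (by rw [hc₄, ← WithZero.exp_zero]; exact WithZero.exp_lt_exp.mpr (by norm_num))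
  haveI : EK.IsElliptic := by rw [hEK, WeierstrassCurve.baseChange]; infer_instance
  obtain ⟨Dv, hD⟩ : ∃ Dv : VariableChange K, (⟨0, 1, 1, -7, 5⟩ : WeierstrassCurve ℚ).localMinimalModel v = Dv • EK := ⟨_, rfl⟩
  have hm : EK.HasMultiplicativeReduction O :=
    (hasMultiplicativeReduction_iff_of_isMinimal_of_eq_smul O hD EK.isUnit_Δ.ne_zero).mp
      (hasMultiplicativeReductionAt_of_valuation_c₄_eq_one hW hc₄ h)
  unfold WeierstrassCurve.HasSplitMultiplicativeReductionAt
  rw [hasSplitMultiplicativeReduction_iff_of_isMinimal_of_eq_smul O hD EK.isUnit_Δ.ne_zero,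
    hasSplitMultiplicativeReduction_iff]
  refine ⟨hm, ?_⟩
  have inj := IsFractionRing.injective O K
  have hc4 : (EK.integralModel O).c₄ = 352 := inj <| by
    rw [integralModel_c₄_eq, map_ofNat, hEK, WeierstrassCurve.baseChange, map_c₄]; rw [c₄_91B1_rat]; norm_num
  have ha1 : (EK.integralModel O).a₁ = 0 := inj <| by
    rw [integralModel_a₁_eq, map_zero, hEK, WeierstrassCurve.baseChange, map_a₁]; simp
  have ha2 : (EK.integralModel O).a₂ = 1 := inj <| by
    rw [integralModel_a₂_eq, map_one, hEK, WeierstrassCurve.baseChange, map_a₂]; simp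
  have hb2 : (EK.integralModel O).b₂ = 4 := inj <| by
    rw [integralModel_b₂_eq, map_ofNat, hEK, WeierstrassCurve.baseChange, map_b₂]; norm_num [WeierstrassCurve.b₂]
  have hb4 : (EK.integralModel O).b₄ = -14 := inj <| by
    rw [integralModel_b₄_eq, map_neg, map_ofNat, hEK, WeierstrassCurve.baseChange, map_b₄]; norm_num [WeierstrassCurve.b₄]
  have hb6 : (EK.integralModel O).b₆ = 21 := inj <| by
    rw [integralModel_b₆_eq, map_ofNat, hEK, WeierstrassCurve.baseChange, map_b₆]; norm_num [WeierstrassCurve.b₆]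
  rw [hc4, ha1, ha2, hb2, hb4, hb6]
  -- `13 = 0`, hence `3978 = 0`, in the residue field `κ(O_v)`
  have hpF : (13 : IsLocalRing.ResidueField O) = 0 := by
    have hker : (13 : ℤ) ∈ RingHom.ker ((IsLocalRing.residue O).comp (algebraMap ℤ O)) := by
      rw [ker_residue_comp_algebraMap ℚ v]; exact hp
    have h := RingHom.mem_ker.mp hker
    rwa [RingHom.comp_apply, map_ofNat, map_ofNat] at h
  have hdiff : (3978 : (IsLocalRing.ResidueField O)[X]) = 0 := by
    rw [show (3978 : (IsLocalRing.ResidueField O)[X]) = C (3978 : IsLocalRing.ResidueField O) from (map_ofNat C 3978).symm,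
      show (3978 : IsLocalRing.ResidueField O) = 13 * 306 by norm_num, hpF, zero_mul, map_zero]
  have hsplit : (C (352 : IsLocalRing.ResidueField O) * ((X - C 4) * (X + C 4))).Splits :=
    (Splits.C _).mul ((Splits.X_sub_C _).mul (Splits.X_add_C _))
  convert hsplit using 1
  simp only [Polynomial.map_sub, Polynomial.map_add, Polynomial.map_mul, Polynomial.map_pow, Polynomial.map_X, Polynomial.map_ofNat, Polynomial.map_zero, Polynomial.map_one, Polynomial.map_neg, map_mul, map_sub, map_add, map_ofNat, map_zero, map_one, map_neg]
  linear_combination hdiff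

/-- At a place with `v(Δ) < 1`, `c₄` is a `v`-unit. [cite: SilvermanAEC2009, VII.5 Prop. 5.1(b)] -/
theorem valuation_c₄_eq_one_91B1 {v : HeightOneSpectrum ℤ} (h : v.valuation ℚ (⟨0, 1, 1, -7, 5⟩ : WeierstrassCurve ℚ).Δ < 1) :
    v.valuation ℚ (⟨0, 1, 1, -7, 5⟩ : WeierstrassCurve ℚ).c₄ = 1 := by
  rcases mem_of_valuation_Δ_lt_one_91B1 h with hp | hp
  · exact valuation_c₄_eq_one_91B1_7 hp
  · exact valuation_c₄_eq_one_91B1_13 hp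

/-- **`W_v(91b1) = −1` at every bad place** (split multiplicative reduction above `7` and above `13`). [cite: Rohrlich1993Compositio, Prop. 2(ii)] -/
theorem localRootNumberAt_of_valuation_Δ_lt_one_91B1 {v : HeightOneSpectrum ℤ} (h : v.valuation ℚ (⟨0, 1, 1, -7, 5⟩ : WeierstrassCurve ℚ).Δ < 1) :
    haveI := isElliptic_91B1
    (⟨0, 1, 1, -7, 5⟩ : WeierstrassCurve ℚ).localRootNumberAt v = -1 := by
  haveI := isElliptic_91B1
  rcases mem_of_valuation_Δ_lt_one_91B1 h with hp | hp
  · exact localRootNumberAt_of_hasSplitMultiplicativeReductionAt (hasSplitMultiplicativeReductionAt_91B1_7 hp h)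
  · exact localRootNumberAt_of_hasSplitMultiplicativeReductionAt (hasSplitMultiplicativeReductionAt_91B1_13 hp h)

/-- A place `v` of `ℤ` containing the prime `p` IS the place `v_p` (`Rat.HeightOneSpectrum.primesEquiv`). [folklore] -/
theorem eq_primesEquiv_symm_of_mem_91B1 {v : HeightOneSpectrum ℤ} {p : ℕ} (hpr : p.Prime) (hp : (p : ℤ) ∈ v.asIdeal) :
    v = (Rat.HeightOneSpectrum.primesEquiv (R := ℤ)).symm ⟨p, hpr⟩ := by
  apply (Rat.HeightOneSpectrum.primesEquiv (R := ℤ)).injective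
  rw [Equiv.apply_symm_apply]
  apply Subtype.ext
  have hgen := Literature.NumberTheory.EllipticCurves.Rat.natGenerator_primesEquiv_symm (Rat.HeightOneSpectrum.primesEquiv v)
  rw [Equiv.symm_apply_apply] at hgen
  have hdvd : (Rat.HeightOneSpectrum.natGenerator v : ℤ) ∣ p := by
    rw [← Literature.NumberTheory.EllipticCurves.Rat.valuation_intCast_lt_one_iff]
    exact (v.valuation_lt_one_iff_mem (p : ℤ)).mpr hp
  have hprv : (Rat.HeightOneSpectrum.primesEquiv v : ℕ).Prime := (Rat.HeightOneSpectrum.primesEquiv v).2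
  rw [← hgen] at hprv ⊢
  exact (Nat.prime_dvd_prime_iff_eq hprv hpr).mp (by exact_mod_cast hdvd)

/-- `v(Δ) < 1` holds exactly at the places above `7` and `13`. [folklore] -/
theorem valuation_Δ_lt_one_iff_91B1 (v : HeightOneSpectrum ℤ) :
    v.valuation ℚ (⟨0, 1, 1, -7, 5⟩ : WeierstrassCurve ℚ).Δ < 1 ↔
      v = (Rat.HeightOneSpectrum.primesEquiv (R := ℤ)).symm ⟨7, by norm_num⟩ ∨ v = (Rat.HeightOneSpectrum.primesEquiv (R := ℤ)).symm ⟨13, by norm_num⟩ := by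
  constructor
  · intro h
    rcases mem_of_valuation_Δ_lt_one_91B1 h with hp | hp
    · exact Or.inl (eq_primesEquiv_symm_of_mem_91B1 (by norm_num) hp)
    · exact Or.inr (eq_primesEquiv_symm_of_mem_91B1 (by norm_num) hp)
  · rintro (rfl | rfl)
    · rw [Δ_91B1_rat, show (-91 : ℚ) = ((-91 : ℤ) : ℚ) by push_cast; ring,
        Literature.NumberTheory.EllipticCurves.Rat.valuation_intCast_lt_one_iff,
        Literature.NumberTheory.EllipticCurves.Rat.natGenerator_primesEquiv_symm]
      norm_num
    · rw [Δ_91B1_rat, show (-91 : ℚ) = ((-91 : ℤ) : ℚ) by push_cast; ring,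
        Literature.NumberTheory.EllipticCurves.Rat.valuation_intCast_lt_one_iff,
        Literature.NumberTheory.EllipticCurves.Rat.natGenerator_primesEquiv_symm]
      norm_num

/-- **The algebraic root number of `91b1` is `−1`**: `−∏ᶠ_v W_v = −(W_7 · W_13) = −((−1)·(−1)) = −1` (Cremona Table 1: `91B1` has rank `1`, odd; two split primes). [cite: CremonaAlgorithms1997, Table 1 (91B1)] -/
theorem algebraicRootNumber_91B1 :
    haveI := isElliptic_91B1
    (⟨0, 1, 1, -7, 5⟩ : WeierstrassCurve ℚ).algebraicRootNumber = -1 := by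
  haveI := isElliptic_91B1
  set v₁ : HeightOneSpectrum ℤ := (Rat.HeightOneSpectrum.primesEquiv (R := ℤ)).symm ⟨7, by norm_num⟩ with hv₁
  set v₂ : HeightOneSpectrum ℤ := (Rat.HeightOneSpectrum.primesEquiv (R := ℤ)).symm ⟨13, by norm_num⟩ with hv₂
  have hne : v₁ ≠ v₂ := by
    intro h
    have h' := congrArg (fun w => ((Rat.HeightOneSpectrum.primesEquiv (R := ℤ)) w : ℕ)) h
    simp only [hv₁, hv₂, Equiv.apply_symm_apply] at h'
    norm_num at h'
  have h1 : (⟨0, 1, 1, -7, 5⟩ : WeierstrassCurve ℚ).localRootNumberAt v₁ = -1 :=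
    localRootNumberAt_of_valuation_Δ_lt_one_91B1 ((valuation_Δ_lt_one_iff_91B1 v₁).mpr (Or.inl hv₁))
  have h2 : (⟨0, 1, 1, -7, 5⟩ : WeierstrassCurve ℚ).localRootNumberAt v₂ = -1 :=
    localRootNumberAt_of_valuation_Δ_lt_one_91B1 ((valuation_Δ_lt_one_iff_91B1 v₂).mpr (Or.inr hv₂))
  have hsupp : (Function.mulSupport fun v : HeightOneSpectrum ℤ => (⟨0, 1, 1, -7, 5⟩ : WeierstrassCurve ℚ).localRootNumberAt v) ⊆ (({v₁, v₂} : Finset (HeightOneSpectrum ℤ)) : Set (HeightOneSpectrum ℤ)) := by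
    intro v hv
    rw [Function.mem_mulSupport] at hv
    simp only [Finset.coe_insert, Finset.coe_singleton, Set.mem_insert_iff, Set.mem_singleton_iff]
    rcases (WeierstrassCurve.valuation_Δ_le_one_of_isIntegralAt (isIntegralAt_91B1 v)).eq_or_lt with h | h
    · exact absurd (localRootNumberAt_of_valuation_Δ_eq_one_91B1 v h) hv
    · exact (valuation_Δ_lt_one_iff_91B1 v).mp h
  rw [WeierstrassCurve.algebraicRootNumber, finprod_eq_prod_of_mulSupport_subset _ hsupp, Finset.prod_pair hne, h1, h2]
  norm_num

end LocalRootNumbers91B1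

/-! ## §3 Semistability, `w(91b1) = −1` from modularity, and `r_an(91b1) = 1` -/
section RootNumber91B1

/-- The conductor `N = 91` of `91b1` is squarefree. [cite: CremonaAlgorithms1997, Table 1 (91B1)] -/
theorem squarefree_conductorNorm_91B1 :
    haveI := isElliptic_91B1
    Squarefree ((⟨0, 1, 1, -7, 5⟩ : WeierstrassCurve ℚ).conductorNorm ℤ) := by
  rw [conductorNorm_91B1]
  rw [show (91 : ℕ) = 7 * 13 by norm_num, Nat.squarefree_mul_iff]
  exact ⟨by norm_num, (show Nat.Prime 7 by norm_num).squarefree, (show Nat.Prime 13 by norm_num).squarefree⟩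

/-- **`91b1` is semistable**: good or multiplicative reduction at every finite place. [cite: SilvermanAEC2009, VII.5 Prop. 5.1] -/
theorem isSemistable_91B1 : (⟨0, 1, 1, -7, 5⟩ : WeierstrassCurve ℚ).IsSemistable ℤ := by
  haveI := isElliptic_91B1
  intro v
  have hint := isIntegralAt_91B1 v
  rcases (WeierstrassCurve.valuation_Δ_le_one_of_isIntegralAt hint).eq_or_lt with h | h
  · exact WeierstrassCurve.isSemistableAt_of_valuation_Δ_eq_one hint h
  · exact WeierstrassCurve.isSemistableAt_of_valuation_c₄_eq_one hint (valuation_c₄_eq_one_91B1 h)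

/-- No place of additive reduction. [cite: SilvermanAEC2009, VII.5 Prop. 5.1] -/
theorem not_hasAdditiveReductionAt_91B1 (v : HeightOneSpectrum ℤ) :
    haveI := isElliptic_91B1
    ¬ (⟨0, 1, 1, -7, 5⟩ : WeierstrassCurve ℚ).HasAdditiveReductionAt v :=
  haveI := isElliptic_91B1
  (WeierstrassCurve.isSemistableAt_iff_not_hasAdditiveReductionAt v _).mp (isSemistable_91B1 v)

/-- **The (analytic) root number of `91b1` is `−1`, from the Modularity Theorem alone** (tree `rootNumber_eq_algebraicRootNumber_of_squarefree`, Atkin–Lehner at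
squarefree level). [cite: CremonaAlgorithms1997, Table 1 (91B1)] [cite: BCDTJAMS2001, Thm. A] [cite: KellockDokchitser2023, Cor. 2.5] -/
theorem rootNumber_91B1 (hmod : exists_isNewformOf) :
    haveI := isElliptic_91B1
    (⟨0, 1, 1, -7, 5⟩ : WeierstrassCurve ℚ).rootNumber = -1 := by
  haveI := isElliptic_91B1
  rw [(WeierstrassCurve.rootNumber_eq_algebraicRootNumber_of_squarefree _ squarefree_conductorNorm_91B1 hmod)
    (fun v h => (not_hasAdditiveReductionAt_91B1 v h).elim), algebraicRootNumber_91B1]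

/-- `ord_{s=1} L(91b1, s)` is odd, from the Modularity Theorem alone (`w = −1` and the unconditional half of parity). [cite: SilvermanAEC2009, C.16 Thm. 16.3 and remark, p. 451] -/
theorem odd_analyticRank_91B1 (hmod : exists_isNewformOf) :
    haveI := isElliptic_91B1
    Odd (⟨0, 1, 1, -7, 5⟩ : WeierstrassCurve ℚ).analyticRank :=
  haveI := isElliptic_91B1
  WeierstrassCurve.odd_analyticRank_of_rootNumber_eq_neg_one (rootNumber_91B1 hmod)

/-- ★ **`ord_{s=1} L(91b1, s) = 1` modulo PRINT + MODULARITY, with NO Gross–Zagier–Kolyvagin input**: odd by `w = −1` (`odd_analyticRank_91B1`) and `≤ 1` by Kriz–Li Thm 4.3 at `d = 1` with the Table-1 (★)-datum (`krizLi_analyticRank_le_one`).  Discharges the `hGZK` of `analyticRank_91B1`: Cremona's `r = 1` for `91B1` as a theorem modulo print + modularity. [cite: CremonaAlgorithms1997, Table 1 (91B1: r = 1)] [cite: KrizLi2019, Thm. 4.3 and §6 Table 1 (row 91b1)] -/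
theorem analyticRank_91B1_of_modularity (h33 : KrizLi2019.thm33_rank_twist) (htab : KrizLi2019.table1_row91b1)
    (hmod : exists_isNewformOf)
    (K : Type) [Field K] [NumberField K] (hK : IsImaginaryQuadratic K) (hdK : NumberField.discr K = -55) :
    haveI := isElliptic_91B1
    (⟨0, 1, 1, -7, 5⟩ : WeierstrassCurve ℚ).analyticRank = 1 := by
  haveI := isElliptic_91B1; haveI := isGloballyMinimal_91B1
  obtain ⟨_, Dt, H, ι, P, j, -, hP, hstar⟩ := htab K hK hdK
  have hle := krizLi_analyticRank_le_one _ h33 twoTorsion_91B1 K hK (satisfiesHeegnerHypothesis_91B1 hK.1 hdK) Dt H ι P hP j hstar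
  obtain ⟨k, hk⟩ := odd_analyticRank_91B1 hmod
  omega

end RootNumber91B1

end Summit.BirchSwinnertonDyer.BirchSwinnertonDyer.Theorems.GenusExact.TwinSwap.KrizLiAnchor91b1

end
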